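import Summits.HubbardSuperconductivity.HubbardSuperconductivity.Theorems.LiebTwinDWavePolarisedDiscordancePairTransfer
import Summits.HubbardSuperconductivity.HubbardSuperconductivity.Theorems.LiebTwinTwinOnsiteCondensationTwinPairOrderIdentity
import Summits.HubbardSuperconductivity.HubbardSuperconductivity.Theorems.LiebTwinRectificationRaisesEnergy
import HarnessLib

/-!
# Route `LiebTwin`, crux `DWavePolarisedDiscordance` (stmt-HubbardSuperconductivity-15314):
# the channel bound of the discordance calculus (helper, `--supports`, stub `stub_discordanceChannelBound`)

Crux K3′ compares, for a sector ground state `φ` and its TWIN `φ̃ = liebVec n |W|` (`W = liebW n φ`,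
`|W| = CFC.abs W`), the on-site increment `m := F_s(φ̃) - F_s(φ)` (the "discordance mass") with the `d`-wave
increment `F_d(φ) - F_d(φ̃)`, `F_g(χ) = Re⟨χ, Δ_gᴴ Δ_g χ⟩`, `Δ_g = pairField g L`. This file machine-checks the
KINEMATIC half of the card's identity calculus (I3)/(I4) (census `STRATEGY-CENSUS.md`, §Decomposition D1:
"provable now; kinematic"), in inequality form and for the whole class of real flip-definite vectors
(`Wᵀ = ±W`, the class of the route's reduction `RealFlipDefiniteSuffices`), on top of the even-form-factor Lieb
transfer of `Theorems/LiebTwinDWavePolarisedDiscordancePairTransfer.lean`: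

* `expect_pairField_liebVec_unitConj` — in the eigenbasis of a Hermitian `W = V D_w Vᴴ`:
  `F_g = Σ_{a,b} w_a w_b Y^g_{ab}`, `Y^g_{ab} = Σ 2 g(e)g(e') N^{xx'}_{ab} conj N^{x+e,x'+e'}_{ab}`, `N^{uv} = Vᴴ B_{uv} V`,
  and the twin is the same expression with `|w_a||w_b|` (`cfcAbs_eq_unitConj`, tree);
* `norm_channelKernel_le` — **the channel bound on the kernel**: `|Y^g_{ab}| ≤ (Σ_e|g(e)|)² · Re Y^s_{ab}`,
  `Re Y^s_{ab} = 2 Σ_{x,x'} |N^{xx'}_{ab}|² ≥ 0` (Cauchy–Schwarz after the translations `x ↦ x+e`, `x' ↦ x'+e'`);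
* `abs_sub_twin_le_of_isHermitian`, `abs_sub_twin_le_of_real` — **the channel bound**:
  `|F_g(φ) - F_g(φ̃)| ≤ (Σ_e|g(e)|)² · (F_s(φ̃) - F_s(φ))` for Hermitian `W`, and for real `φ` with `Wᵀ = ±W`
  (the antisymmetric half via `iW` Hermitian, `|iW| = |W|`, `CFC.abs_smul`);
* `abs_dWave_sub_twin_le`, `abs_extendedS_sub_twin_le` (constant `(Σ|g|)² = 16`),
  `re_expect_sWave_le_twin_of_real` (`m ≥ 0` on the whole flip-definite class; the route's support
  `OnsiteRectificationMonotone` is the symmetric half), `dWaveDiscordance_of_small_mass` (K3′'s inequality at `φ`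
  follows from `(κ + 16)·m ≤ ε·L⁴`: the crux has content only where the mass is macroscopic, and there it forces
  `κ ≤ 16`), and the registered stub `stub_discordanceChannelBound`.

The constant 16 is asymptotically sharp (census §Negation N1(a): the `n = 1` two-standing-wave vector on the
`6 × 6` torus has `m = 4`, `F_d(φ) - F_d(φ̃) = -48`, ratio `12 → 16` as the second wave vector tends to `(π,0)`).
Sources: E. H. Lieb, PRL **62** (1989) 1201, proof of Theorem 1 (spectral coordinates, `w_i w_j ≤ |w_i||w_j|`);
D. J. Scalapino, Phys. Rep. **250** (1995) 329, §2 (pair fields and form factors); C. N. Yang, PRL **63** (1989)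
2144 (the transfer of pair operators). Everything is finite-dimensional bookkeeping; no definition and no named
fact is introduced.
-/


-- the mandated namespace `Summit.<Summit>.<Problem>.Theorems` repeats `HubbardSuperconductivity`
-- (single-problem summit, D-0017), which the `dupNamespace` linter flags on every declaration
set_option linter.dupNamespace false

noncomputable section

namespace Summit.HubbardSuperconductivity.HubbardSuperconductivity.Theorems.LiebTwinDiscordance

open Matrix Finset Literature.MathematicalPhysics.QuantumLattice Literature.Probability.LatticeModels
open Summit.HubbardSuperconductivity.EnslavedA1g (zero_notMem_unitSteps sum_unitSteps_neg)
open scoped ComplexOrder MatrixOrder Matrix.Norms.L2Operator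

/-! ### The channel bound on the torus -/

section ChannelBound

variable {L : ℕ} [NeZero L]

/-- `Σ_{e ∈ {0,±e₁,±e₂}} sWave(e) · F(e) = F(0)` (only the step `e = 0` carries on-site weight). [folklore] -/
theorem sum_sWave_mul {M : Type*} [AddCommMonoid M] [Module ℝ M] (F : Site 2 → M) :
    ∑ e ∈ insert (0 : Site 2) unitSteps, sWave e • F e = F 0 := by
  rw [Finset.sum_insert zero_notMem_unitSteps, show sWave 0 = 1 from if_pos rfl, one_smul,
    Finset.sum_eq_zero (fun e he => ?_), add_zero]
  have hne : e ≠ 0 := fun h => zero_notMem_unitSteps (h ▸ he)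
  rw [show sWave e = 0 from if_neg hne, zero_smul]

/-- **The pair order of a Hermitian Lieb matrix in spectral coordinates.** For even `g`, `U_f = V D_f Vᴴ`:
`⟨liebVec U_f, Δ_gᴴ Δ_g liebVec U_f⟩ = Σ_{a,b} f_a f_b Y^g_{ab}`,
`Y^g_{ab} = Σ_{x,e,x',e'} 2 g(e) g(e') N^{xx'}_{ab} conj(N^{x+e,x'+e'}_{ab})`, `N^{uv} = Vᴴ B_{uv} V`.
Lieb, PRL 62 (1989) 1201, proof of Theorem 1; Scalapino, Phys. Rep. 250 (1995) 329, §2. [folklore] -/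
theorem expect_pairField_liebVec_unitConj (g : Site 2 → ℝ) (hg : ∀ e, g (-e) = g e) {n : ℕ}
    (V : Matrix (Config (FermionTorus 2 L) n) (Config (FermionTorus 2 L) n) ℂ)
    (f : Config (FermionTorus 2 L) n → ℝ) :
    expect ((pairField g L)ᴴ * pairField g L) (liebVec n (unitConj V f)) =
      ∑ a, ∑ b, (f a : ℂ) * (f b : ℂ) *
        ∑ x : TorusSite 2 L, ∑ e ∈ insert (0 : Site 2) unitSteps,
          ∑ x' : TorusSite 2 L, ∑ e' ∈ insert (0 : Site 2) unitSteps,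
            ((2 * (g e * g e') : ℝ) : ℂ) *
              ((Vᴴ * configHop n (FermionTorus.ofTorusSite x) (FermionTorus.ofTorusSite x') * V) a b *
                star ((Vᴴ * configHop n (FermionTorus.ofTorusSite (x + Torus.proj L e))
                  (FermionTorus.ofTorusSite (x' + Torus.proj L e')) * V) a b)) := by
  rw [expect_pairField_eq_of_even L g hg (isInSector_liebVec n _), LiebThm1.liebW_liebVec]
  have hterm : ∀ (u v u' v' : FermionTorus 2 L),
      ((unitConj V f)ᴴ * (configHop n u v * (unitConj V f * (configHop n u' v')ᵀ))).trace =
        ∑ a, ∑ b, (f a : ℂ) * (f b : ℂ) *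
          ((Vᴴ * configHop n u v * V) a b * star ((Vᴴ * configHop n u' v' * V) a b)) := by
    intro u v u' v'
    rw [unitConj_conjTranspose, LiebTwinTwin.configHop_transpose,
      ← LiebTwinTwin.configHop_conjTranspose n u' v',
      show unitConj V f * (configHop n u v * (unitConj V f * (configHop n u' v')ᴴ)) =
        unitConj V f * configHop n u v * unitConj V f * (configHop n u' v')ᴴ by
          simp only [Matrix.mul_assoc],
      trace_unitConj_mul_mul_unitConj_mul_conjTranspose]
  simp_rw [hterm, Finset.mul_sum]
  rw [sum_sum_sum_sum_comm₂]
  refine Finset.sum_congr rfl fun a _ => Finset.sum_congr rfl fun b _ => ?_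
  refine Finset.sum_congr rfl fun x _ => Finset.sum_congr rfl fun e _ =>
    Finset.sum_congr rfl fun x' _ => Finset.sum_congr rfl fun e' _ => ?_
  ring

/-- **The channel bound on the discordance kernel.** For every form factor `g` and every pair of spectral
labels `a, b`: `|Y^g_{ab}| ≤ (Σ_e |g e|)² · Re Y^s_{ab}`, where `Y^s_{ab} = 2 Σ_{x,x'} |N^{xx'}_{ab}|²` is the
on-site kernel (shifted Cauchy–Schwarz in the translations `x ↦ x + e`, `x' ↦ x' + e'`). [folklore] -/
theorem norm_channelKernel_le (g : Site 2 → ℝ) {n : ℕ}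
    (V : Matrix (Config (FermionTorus 2 L) n) (Config (FermionTorus 2 L) n) ℂ)
    (a b : Config (FermionTorus 2 L) n) :
    ‖∑ x : TorusSite 2 L, ∑ e ∈ insert (0 : Site 2) unitSteps,
        ∑ x' : TorusSite 2 L, ∑ e' ∈ insert (0 : Site 2) unitSteps,
          ((2 * (g e * g e') : ℝ) : ℂ) *
            ((Vᴴ * configHop n (FermionTorus.ofTorusSite x) (FermionTorus.ofTorusSite x') * V) a b *
              star ((Vᴴ * configHop n (FermionTorus.ofTorusSite (x + Torus.proj L e))
                (FermionTorus.ofTorusSite (x' + Torus.proj L e')) * V) a b))‖ ≤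
      (∑ e ∈ insert (0 : Site 2) unitSteps, |g e|) ^ 2 *
        (∑ x : TorusSite 2 L, ∑ e ∈ insert (0 : Site 2) unitSteps,
          ∑ x' : TorusSite 2 L, ∑ e' ∈ insert (0 : Site 2) unitSteps,
            ((2 * (sWave e * sWave e') : ℝ) : ℂ) *
              ((Vᴴ * configHop n (FermionTorus.ofTorusSite x) (FermionTorus.ofTorusSite x') * V) a b *
                star ((Vᴴ * configHop n (FermionTorus.ofTorusSite (x + Torus.proj L e))
                  (FermionTorus.ofTorusSite (x' + Torus.proj L e')) * V) a b))).re := by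
  -- name the one-body matrix elements
  set N : TorusSite 2 L → TorusSite 2 L → ℂ := fun y y' =>
    (Vᴴ * configHop n (FermionTorus.ofTorusSite y) (FermionTorus.ofTorusSite y') * V) a b with hN
  -- the on-site kernel is `2 Σ |N|²`
  have hs : (∑ x : TorusSite 2 L, ∑ e ∈ insert (0 : Site 2) unitSteps,
      ∑ x' : TorusSite 2 L, ∑ e' ∈ insert (0 : Site 2) unitSteps,
        ((2 * (sWave e * sWave e') : ℝ) : ℂ) * (N x x' * star (N (x + Torus.proj L e) (x' + Torus.proj L e')))) =
      ((2 * ∑ x : TorusSite 2 L, ∑ x' : TorusSite 2 L, ‖N x x'‖ ^ 2 : ℝ) : ℂ) := by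
    have h1 : ∀ (x x' : TorusSite 2 L) (e : Site 2),
        ∑ e' ∈ insert (0 : Site 2) unitSteps,
          ((2 * (sWave e * sWave e') : ℝ) : ℂ) * (N x x' * star (N (x + Torus.proj L e) (x' + Torus.proj L e'))) =
        ((2 * sWave e : ℝ) : ℂ) * (N x x' * star (N (x + Torus.proj L e) x')) := by
      intro x x' e
      have := sum_sWave_mul (M := ℂ) (fun e' =>
        ((2 * sWave e : ℝ) : ℂ) * (N x x' * star (N (x + Torus.proj L e) (x' + Torus.proj L e'))))
      simp only [EnslavedA1g.torusProj_zero, add_zero] at this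
      rw [← this]
      refine Finset.sum_congr rfl fun e' _ => ?_
      rw [Complex.real_smul]; push_cast; ring
    have h2 : ∀ (x x' : TorusSite 2 L),
        ∑ e ∈ insert (0 : Site 2) unitSteps, ((2 * sWave e : ℝ) : ℂ) * (N x x' * star (N (x + Torus.proj L e) x')) =
        (2 : ℂ) * (N x x' * star (N x x')) := by
      intro x x'
      have := sum_sWave_mul (M := ℂ) (fun e => (2 : ℂ) * (N x x' * star (N (x + Torus.proj L e) x')))
      simp only [EnslavedA1g.torusProj_zero, add_zero] at this
      rw [← this]
      refine Finset.sum_congr rfl fun e _ => ?_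
      rw [Complex.real_smul]; push_cast; ring
    simp_rw [h1]
    refine (Finset.sum_congr rfl fun x _ => Finset.sum_comm).trans ?_
    simp_rw [h2]
    push_cast
    rw [Finset.mul_sum]
    refine Finset.sum_congr rfl fun x _ => ?_
    rw [Finset.mul_sum]
    refine Finset.sum_congr rfl fun x' _ => ?_
    rw [Complex.star_def, Complex.mul_conj']
  -- reorder the general kernel with the steps outside
  have hg' : (∑ x : TorusSite 2 L, ∑ e ∈ insert (0 : Site 2) unitSteps,
      ∑ x' : TorusSite 2 L, ∑ e' ∈ insert (0 : Site 2) unitSteps,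
        ((2 * (g e * g e') : ℝ) : ℂ) * (N x x' * star (N (x + Torus.proj L e) (x' + Torus.proj L e')))) =
      ∑ e ∈ insert (0 : Site 2) unitSteps, ∑ e' ∈ insert (0 : Site 2) unitSteps,
        ((2 * (g e * g e') : ℝ) : ℂ) *
          ∑ x : TorusSite 2 L, ∑ x' : TorusSite 2 L, N x x' * star (N (x + Torus.proj L e) (x' + Torus.proj L e')) := by
    rw [Finset.sum_comm]
    refine Finset.sum_congr rfl fun e _ => ?_
    have : ∀ x : TorusSite 2 L, ∑ x' : TorusSite 2 L, ∑ e' ∈ insert (0 : Site 2) unitSteps,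
        ((2 * (g e * g e') : ℝ) : ℂ) * (N x x' * star (N (x + Torus.proj L e) (x' + Torus.proj L e'))) =
        ∑ e' ∈ insert (0 : Site 2) unitSteps, ∑ x' : TorusSite 2 L,
          ((2 * (g e * g e') : ℝ) : ℂ) * (N x x' * star (N (x + Torus.proj L e) (x' + Torus.proj L e'))) :=
      fun x => Finset.sum_comm
    simp_rw [this]
    rw [Finset.sum_comm]
    refine Finset.sum_congr rfl fun e' _ => ?_
    simp_rw [Finset.mul_sum]
  -- the shifted Cauchy–Schwarz bound, step by step
  have hshift : ∀ e e' : Site 2,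
      ‖∑ x : TorusSite 2 L, ∑ x' : TorusSite 2 L, N x x' * star (N (x + Torus.proj L e) (x' + Torus.proj L e'))‖ ≤
        ∑ x : TorusSite 2 L, ∑ x' : TorusSite 2 L, ‖N x x'‖ ^ 2 := fun e e' =>
    norm_sum_sum_mul_star_shift_le (Equiv.addRight (Torus.proj L e)) (Equiv.addRight (Torus.proj L e')) N
  change ‖∑ x : TorusSite 2 L, ∑ e ∈ insert (0 : Site 2) unitSteps,
      ∑ x' : TorusSite 2 L, ∑ e' ∈ insert (0 : Site 2) unitSteps,
        ((2 * (g e * g e') : ℝ) : ℂ) * (N x x' * star (N (x + Torus.proj L e) (x' + Torus.proj L e')))‖ ≤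
      (∑ e ∈ insert (0 : Site 2) unitSteps, |g e|) ^ 2 *
        (∑ x : TorusSite 2 L, ∑ e ∈ insert (0 : Site 2) unitSteps,
          ∑ x' : TorusSite 2 L, ∑ e' ∈ insert (0 : Site 2) unitSteps,
            ((2 * (sWave e * sWave e') : ℝ) : ℂ) * (N x x' * star (N (x + Torus.proj L e) (x' + Torus.proj L e')))).re
  rw [hs, hg', Complex.ofReal_re]
  set S : ℝ := ∑ x : TorusSite 2 L, ∑ x' : TorusSite 2 L, ‖N x x'‖ ^ 2 with hS
  have hS0 : 0 ≤ S := Finset.sum_nonneg fun _ _ => Finset.sum_nonneg fun _ _ => by positivity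
  calc ‖∑ e ∈ insert (0 : Site 2) unitSteps, ∑ e' ∈ insert (0 : Site 2) unitSteps,
          ((2 * (g e * g e') : ℝ) : ℂ) *
            ∑ x : TorusSite 2 L, ∑ x' : TorusSite 2 L, N x x' * star (N (x + Torus.proj L e) (x' + Torus.proj L e'))‖
      ≤ ∑ e ∈ insert (0 : Site 2) unitSteps, ∑ e' ∈ insert (0 : Site 2) unitSteps, 2 * (|g e| * |g e'|) * S := by
        refine (norm_sum_le _ _).trans (Finset.sum_le_sum fun e _ => ?_)
        refine (norm_sum_le _ _).trans (Finset.sum_le_sum fun e' _ => ?_)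
        rw [norm_mul, Complex.norm_real, Real.norm_eq_abs, abs_mul, abs_mul, abs_two]
        exact mul_le_mul_of_nonneg_left (hshift e e') (by positivity)
    _ = (∑ e ∈ insert (0 : Site 2) unitSteps, |g e|) ^ 2 * (2 * S) := by
        rw [sq, Finset.sum_mul_sum, Finset.sum_mul]
        refine Finset.sum_congr rfl fun e _ => ?_
        rw [Finset.sum_mul]
        refine Finset.sum_congr rfl fun e' _ => ?_
        ring

end ChannelBound

/-! ### The channel bound for sector vectors with a Hermitian / real flip-definite Lieb matrix -/

section Main

variable {L : ℕ} [NeZero L]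

/-- **Channel bound of the discordance calculus (Hermitian Lieb matrix).** For every even form factor `g`
and every `(n, n)`-sector vector `φ` of the torus whose Lieb matrix `W = liebW n φ` is Hermitian, the change
of the `g`-channel pair order under Lieb rectification `W ↦ |W|` is controlled by the on-site increment:
`|F_g(φ) - F_g(φ̃)| ≤ (Σ_e |g(e)|)² · (F_s(φ̃) - F_s(φ))`, `φ̃ = liebVec n |W|`,
`F_g(χ) = Re⟨χ, Δ_gᴴ Δ_g χ⟩`. In the eigenbasis of `W` both sides are `Σ_{a,b} (|w_a||w_b| - w_a w_b)·(kernel)`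
with nonnegative coefficients, and the `g`-kernel is bounded by `(Σ|g|)²` times the on-site kernel
(shifted Cauchy–Schwarz). This is the inequality form of the card's identities (I3)/(I4)
(`m = 8Σq ≥ 0`, `|ΔF_d| ≤ 16·m`). Lieb, PRL 62 (1989) 1201, proof of Theorem 1; Scalapino, Phys. Rep. 250
(1995) 329, §2. [folklore] -/
theorem abs_sub_twin_le_of_isHermitian (g : Site 2 → ℝ) (hg : ∀ e, g (-e) = g e) {n : ℕ}
    {φ : Fock (Orb (FermionTorus 2 L))} (hφ : IsInSector n n φ) (hW : (liebW n φ).IsHermitian) :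
    |(expect ((pairField g L)ᴴ * pairField g L) φ).re -
        (expect ((pairField g L)ᴴ * pairField g L) (liebVec n (CFC.abs (liebW n φ)))).re| ≤
      (∑ e ∈ insert (0 : Site 2) unitSteps, |g e|) ^ 2 *
        ((expect ((pairField sWave L)ᴴ * pairField sWave L) (liebVec n (CFC.abs (liebW n φ)))).re -
          (expect ((pairField sWave L)ᴴ * pairField sWave L) φ).re) := by
  set V : Matrix (Config (FermionTorus 2 L) n) (Config (FermionTorus 2 L) n) ℂ :=
    (hW.eigenvectorUnitary : Matrix (Config (FermionTorus 2 L) n) (Config (FermionTorus 2 L) n) ℂ) with hV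
  set f : Config (FermionTorus 2 L) n → ℝ := hW.eigenvalues with hf
  have hWeq : liebW n φ = unitConj V f := eq_unitConj_eigenvalues hW
  have habs : CFC.abs (liebW n φ) = unitConj V |f| := cfcAbs_eq_unitConj hW
  have hφeq : φ = liebVec n (unitConj V f) := by rw [← hWeq, LiebThm1.liebVec_liebW hφ]
  rw [habs]
  conv_lhs => rw [hφeq]
  conv_rhs => rw [hφeq]
  rw [expect_pairField_liebVec_unitConj g hg V f, expect_pairField_liebVec_unitConj g hg V |f|,
    expect_pairField_liebVec_unitConj sWave (fun e => by simp [sWave, neg_eq_zero]) V f,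
    expect_pairField_liebVec_unitConj sWave (fun e => by simp [sWave, neg_eq_zero]) V |f|]
  simp only [Pi.abs_apply]
  exact abs_re_sum_sub_le f _ _ _ (norm_channelKernel_le g V)

/-- `IsInSector` is stable under scalars. [folklore] -/
theorem isInSector_smul {Λ : Type*} [LinearOrder Λ] [Fintype Λ] {n : ℕ} {ψ : Fock (Orb Λ)}
    (hψ : IsInSector n n ψ) (c : ℂ) : IsInSector n n (c • ψ) := by
  intro s hs
  rw [Pi.smul_apply, hψ s hs, smul_zero]

/-- Expectations are phase invariant: `⟨iψ, A iψ⟩ = ⟨ψ, A ψ⟩`. [folklore] -/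
theorem expect_I_smul {ι : Type*} [Fintype ι] (A : Matrix (Finset ι) (Finset ι) ℂ) (ψ : Fock ι) :
    expect A (Complex.I • ψ) = expect A ψ := by
  simp only [Literature.MathematicalPhysics.QuantumLattice.expect, Matrix.mulVec_smul, star_smul,
    smul_dotProduct, dotProduct_smul, smul_smul, Complex.star_def, Complex.conj_I]
  rw [show Complex.I * -Complex.I = 1 by rw [mul_neg, Complex.I_mul_I, neg_neg], one_smul]

/-- A real wave function with ANTIsymmetric Lieb matrix `Wᵀ = -W` has `i·W` Hermitian, i.e. `i φ` falls under
the Hermitian case, with the same twin (`|iW| = |W|`) and the same pair orders. Lieb, PRL 62 (1989) 1201, proof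
of Theorem 1 ("W Hermitian WLOG"). [folklore] -/
theorem isHermitian_liebW_I_smul_of_real_antisymm {Λ : Type*} [LinearOrder Λ] [Fintype Λ] {n : ℕ}
    {φ : Fock (Orb Λ)} (hreal : ∀ s, star (φ s) = φ s) (hanti : (liebW n φ)ᵀ = -liebW n φ) :
    (liebW n (Complex.I • φ)).IsHermitian := by
  have hstar : ∀ α β : Config Λ n, star (liebW n φ α β) = liebW n φ α β := by
    intro α β
    rw [liebW_apply, star_mul', LiebThm1.star_pairSign, hreal]
  have hH : (liebW n φ)ᴴ = -liebW n φ := by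
    rw [← hanti]
    ext α β
    rw [conjTranspose_apply, transpose_apply, hstar]
  change (liebW n (Complex.I • φ))ᴴ = liebW n (Complex.I • φ)
  rw [liebW_smul, conjTranspose_smul, hH, Complex.star_def, Complex.conj_I, smul_neg, neg_smul, neg_neg]

/-- **Channel bound of the discordance calculus (real flip-definite vectors)** — the class of the route's
reduction `RealFlipDefiniteSuffices`: for every even `g` and every REAL `(n, n)`-sector `φ` with
`Wᵀ = W` or `Wᵀ = -W` (`W = liebW n φ`),
`|F_g(φ) - F_g(φ̃)| ≤ (Σ_e |g(e)|)² · (F_s(φ̃) - F_s(φ))`. Lieb, PRL 62 (1989) 1201, proof of Theorem 1;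
Scalapino, Phys. Rep. 250 (1995) 329, §2. [folklore] -/
theorem abs_sub_twin_le_of_real (g : Site 2 → ℝ) (hg : ∀ e, g (-e) = g e) {n : ℕ}
    {φ : Fock (Orb (FermionTorus 2 L))} (hreal : ∀ s, star (φ s) = φ s) (hφ : IsInSector n n φ)
    (hflip : (liebW n φ)ᵀ = liebW n φ ∨ (liebW n φ)ᵀ = -liebW n φ) :
    |(expect ((pairField g L)ᴴ * pairField g L) φ).re -
        (expect ((pairField g L)ᴴ * pairField g L) (liebVec n (CFC.abs (liebW n φ)))).re| ≤
      (∑ e ∈ insert (0 : Site 2) unitSteps, |g e|) ^ 2 *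
        ((expect ((pairField sWave L)ᴴ * pairField sWave L) (liebVec n (CFC.abs (liebW n φ)))).re -
          (expect ((pairField sWave L)ᴴ * pairField sWave L) φ).re) := by
  rcases hflip with hsym | hanti
  · exact abs_sub_twin_le_of_isHermitian g hg hφ (isHermitian_liebW_of_real hreal hsym)
  · have key := abs_sub_twin_le_of_isHermitian g hg (isInSector_smul hφ Complex.I)
      (isHermitian_liebW_I_smul_of_real_antisymm hreal hanti)
    have htwin : liebVec n (CFC.abs (liebW n (Complex.I • φ))) = liebVec n (CFC.abs (liebW n φ)) := by
      rw [liebW_smul, CFC.abs_smul, Complex.norm_I, one_smul]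
    rwa [htwin, expect_I_smul, expect_I_smul] at key

/-- **`d`-channel bound**: for real flip-definite sector vectors,
`|F_d(φ) - F_d(φ̃)| ≤ 16 · (F_s(φ̃) - F_s(φ))` (`Σ_e |g_d(e)| = 4`; the constant is asymptotically sharp:
the `n = 1` two-standing-wave witness of the crux census has `|ΔF_d|/m = 12 → 16`).
Lieb, PRL 62 (1989) 1201; Scalapino, Phys. Rep. 250 (1995) 329, §2. [folklore] -/
theorem abs_dWave_sub_twin_le {n : ℕ} {φ : Fock (Orb (FermionTorus 2 L))}
    (hreal : ∀ s, star (φ s) = φ s) (hφ : IsInSector n n φ)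
    (hflip : (liebW n φ)ᵀ = liebW n φ ∨ (liebW n φ)ᵀ = -liebW n φ) :
    |(expect ((pairField dWaveFormFactor L)ᴴ * pairField dWaveFormFactor L) φ).re -
        (expect ((pairField dWaveFormFactor L)ᴴ * pairField dWaveFormFactor L)
          (liebVec n (CFC.abs (liebW n φ)))).re| ≤
      16 * ((expect ((pairField sWave L)ᴴ * pairField sWave L) (liebVec n (CFC.abs (liebW n φ)))).re -
        (expect ((pairField sWave L)ᴴ * pairField sWave L) φ).re) := by
  have h := abs_sub_twin_le_of_real dWaveFormFactor dWaveFormFactor_neg hreal hφ hflip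
  rw [PinnedFrame.sum_abs_dWaveFormFactor] at h
  norm_num at h
  exact h

/-- **Extended-`s` channel bound**: for real flip-definite sector vectors,
`|F_xs(φ) - F_xs(φ̃)| ≤ 16 · (F_s(φ̃) - F_s(φ))`. Lieb, PRL 62 (1989) 1201; Scalapino, Phys. Rep. 250 (1995)
329, §2. [folklore] -/
theorem abs_extendedS_sub_twin_le {n : ℕ} {φ : Fock (Orb (FermionTorus 2 L))}
    (hreal : ∀ s, star (φ s) = φ s) (hφ : IsInSector n n φ)
    (hflip : (liebW n φ)ᵀ = liebW n φ ∨ (liebW n φ)ᵀ = -liebW n φ) :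
    |(expect ((pairField extendedSWave L)ᴴ * pairField extendedSWave L) φ).re -
        (expect ((pairField extendedSWave L)ᴴ * pairField extendedSWave L)
          (liebVec n (CFC.abs (liebW n φ)))).re| ≤
      16 * ((expect ((pairField sWave L)ᴴ * pairField sWave L) (liebVec n (CFC.abs (liebW n φ)))).re -
        (expect ((pairField sWave L)ᴴ * pairField sWave L) φ).re) := by
  have h := abs_sub_twin_le_of_real extendedSWave extendedSWave_even hreal hφ hflip
  rw [sum_abs_extendedSWave] at h
  norm_num at h
  exact h

/-- **On-site rectification monotonicity for the whole real flip-definite class** (`Wᵀ = ±W`; the route's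
support `OnsiteRectificationMonotone` is the symmetric half): `F_s(φ) ≤ F_s(φ̃)`.
Lieb, PRL 62 (1989) 1201, proof of Theorem 1. [folklore] -/
theorem re_expect_sWave_le_twin_of_real {n : ℕ} {φ : Fock (Orb (FermionTorus 2 L))}
    (hreal : ∀ s, star (φ s) = φ s) (hφ : IsInSector n n φ)
    (hflip : (liebW n φ)ᵀ = liebW n φ ∨ (liebW n φ)ᵀ = -liebW n φ) :
    (expect ((pairField sWave L)ᴴ * pairField sWave L) φ).re ≤
      (expect ((pairField sWave L)ᴴ * pairField sWave L) (liebVec n (CFC.abs (liebW n φ)))).re := by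
  have h := abs_sub_twin_le_of_real sWave (fun e => by simp [sWave, neg_eq_zero]) hreal hφ hflip
  rw [sum_abs_sWave, one_pow, one_mul] at h
  linarith [abs_nonneg ((expect ((pairField sWave L)ᴴ * pairField sWave L) φ).re -
    (expect ((pairField sWave L)ᴴ * pairField sWave L) (liebVec n (CFC.abs (liebW n φ)))).re)]

/-- **K3′ is automatic where the discordance mass is small** (the parenthesis "vacuous where the mass is
`o(L⁴)`" of the crux, made quantitative): for a real flip-definite sector vector `φ` and `κ, ε, L`, if
`(κ + 16)·m ≤ ε·L⁴` with `m = F_s(φ̃) - F_s(φ)`, then `κ·m - ε·L⁴ ≤ F_d(φ) - F_d(φ̃)`. Hence K3′ at `(U, δ)`,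
restricted to real flip-definite ground states, has content only along ground states with `m ≍ L⁴` (the
K2 regime). Lieb, PRL 62 (1989) 1201; Scalapino, Phys. Rep. 250 (1995) 329. [folklore] -/
theorem dWaveDiscordance_of_small_mass {n : ℕ} {φ : Fock (Orb (FermionTorus 2 L))}
    (hreal : ∀ s, star (φ s) = φ s) (hφ : IsInSector n n φ)
    (hflip : (liebW n φ)ᵀ = liebW n φ ∨ (liebW n φ)ᵀ = -liebW n φ) {κ ε : ℝ}
    (hsmall : (κ + 16) *
        ((expect ((pairField sWave L)ᴴ * pairField sWave L) (liebVec n (CFC.abs (liebW n φ)))).re -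
          (expect ((pairField sWave L)ᴴ * pairField sWave L) φ).re) ≤ ε * (L : ℝ) ^ 4) :
    κ * ((expect ((pairField sWave L)ᴴ * pairField sWave L) (liebVec n (CFC.abs (liebW n φ)))).re -
          (expect ((pairField sWave L)ᴴ * pairField sWave L) φ).re) - ε * (L : ℝ) ^ 4 ≤
      (expect ((pairField dWaveFormFactor L)ᴴ * pairField dWaveFormFactor L) φ).re -
        (expect ((pairField dWaveFormFactor L)ᴴ * pairField dWaveFormFactor L)
          (liebVec n (CFC.abs (liebW n φ)))).re := by
  have h := abs_dWave_sub_twin_le hreal hφ hflip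
  rw [abs_le] at h
  linarith [h.1]

end Main

/-! ### The registered stub of the crux (route vocabulary) -/

/-- **STUB `stub_discordanceChannelBound`** of crux `DWavePolarisedDiscordance` (stmt-HubbardSuperconductivity-15314),
the kinematic half of the card's identity calculus (I3)/(I4): on every torus, for every real `(n, n)`-sector
vector with flip-definite Lieb matrix, `|F_d(φ) - F_d(φ̃)| ≤ 16·(F_s(φ̃) - F_s(φ))` — the `d`-wave discordance is
at most sixteen times the discordance mass (and the mass is nonnegative). Consequently K3′ can fail only along
ground states with macroscopic mass, and there `κ ≤ 16` is forced. Lieb, PRL 62 (1989) 1201, proof of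
Theorem 1; Scalapino, Phys. Rep. 250 (1995) 329, §2. [folklore] -/
theorem stub_discordanceChannelBound :
    open Literature.MathematicalPhysics.QuantumLattice in open scoped MatrixOrder Matrix.Norms.L2Operator in
    ∀ (L : ℕ) [NeZero L] (n : ℕ) (φ : Fock (Orb (FermionTorus 2 L))), (∀ s, star (φ s) = φ s) →
      IsInSector n n φ → ((liebW n φ)ᵀ = liebW n φ ∨ (liebW n φ)ᵀ = -liebW n φ) →
        |(expect ((pairField dWaveFormFactor L)ᴴ * pairField dWaveFormFactor L) φ).re -
            (expect ((pairField dWaveFormFactor L)ᴴ * pairField dWaveFormFactor L)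
              (liebVec n (CFC.abs (liebW n φ)))).re| ≤
          16 * ((expect ((pairField sWave L)ᴴ * pairField sWave L) (liebVec n (CFC.abs (liebW n φ)))).re -
            (expect ((pairField sWave L)ᴴ * pairField sWave L) φ).re) :=
  fun _ _ _ _ hreal hφ hflip => abs_dWave_sub_twin_le hreal hφ hflip

end Summit.HubbardSuperconductivity.HubbardSuperconductivity.Theorems.LiebTwinDiscordance

end
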